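import Literature.NumberTheory.Automorphic.AdelicUnitaryGroupMeasure
import Literature.NumberTheory.Automorphic.AutomorphicSpectrumCompactQuotient
import HarnessLib

/-!
# The regular representation of an anisotropic unitary group decomposes discretely

Topic `NumberTheory/Automorphic`; namespace `Literature.NumberTheory.Automorphic` (grouping
sub-namespace `UnitaryGroup`). Proof file: theorems only, no definition, no named fact, no `sorry`;
imports = tree.

For the unitary group `U(H)` of a hermitian matrix `H ∈ M_N(L)` over a CM field `L` — the adelic group
datum `UnitaryGroup.cmDatum L N H` of `AdelicUnitaryGroupDatum` (`Adelic = adelicUnitaryGroup L H`,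
`A_G = ⊥`), equal by `rfl` to the tree's generic `UnitaryGroup.adelicGroupData L⁺ L c N H`
(`adelicGroupData_eq_cmDatum`) — and an automorphic measure `μ` on `U(H)(𝔸_{L⁺}) ⧸ U(H)(L⁺)`
(which EXISTS for anisotropic `H`: `UnitaryGroup.exists_isAutomorphicMeasure_cmDatum`,
`AdelicUnitaryGroupMeasure`), the tree's regular representation
`(cmDatum L N H).rightRegular μ` of `U(H)(𝔸_{L⁺})` on `L²(U(H)(𝔸_{L⁺}) ⧸ U(H)(L⁺), μ)`
(`AutomorphicSpectrum`; `(R g φ)(x) = φ(g⁻¹ • x)`) is unitary and strongly continuous (generic: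
`isUnitary_rightRegular`, `isStronglyContinuous_rightRegular_holds`), and:

* `UnitaryGroup.isDiscretelyDecomposable_rightRegular_cmDatum` — **for anisotropic `H`, `L²` is the
  closed span of its irreducible closed invariant subspaces** (`L² = L²_disc`,
  `discreteSpectrum_cmDatum_eq_top`): Gelfand–Graev–Piatetski-Shapiro for the compact quotient
  `U(H)(L⁺) \ U(H)(𝔸_{L⁺})` (tree `AdelicGroupData.isDiscretelyDecomposable_rightRegular_of_locallyCompactSpace`,
  `AutomorphicSpectrumCompactQuotient`, with `compactSpace_cmDatum_automorphicQuotient` = Godement's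
  criterion and the local compactness / second countability of `U(H)(𝔸_{L⁺}) ≤ GL_N(𝔸_L)`);
* `UnitaryGroup.isDiscretelyDecomposable_rightRegular_of_compactSpace_cmDatum` — the tree's named fact
  `isDiscretelyDecomposable_rightRegular_of_compactSpace` HOLDS for the unitary datum (any `H`, any
  automorphic `μ`);
* `UnitaryGroup.exists_isAutomorphicMeasure_isDiscretelyDecomposable_cmDatum` — packaged: for
  anisotropic `H` there is an automorphic measure `μ` for which the regular representation on `L²(μ)`
  decomposes discretely; `…_of_posDef` — `H` definite at one complex place; `…_adelicGroupData` — the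
  same over the generic datum.

## References

* I. M. Gelfand, M. I. Graev, I. I. Piatetski-Shapiro, *Representation Theory and Automorphic
  Functions* (1969), Ch. 1 §2. [GelfandGraevPiatetskiShapiro1969]
* A. Deitmar, S. Echterhoff, *Principles of Harmonic Analysis*, 2nd ed. (2014), Thm. 9.2.2.
  [DeitmarEchterhoff2014]
* A. Borel, H. Jacquet, *Automorphic forms and automorphic representations*, PSPM 33 (1979), §4.6.
  [BorelJacquet1979]
-/

noncomputable section

open MeasureTheory Measure Topology NumberField
open scoped ComplexOrder

namespace Literature.NumberTheory.Automorphic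

namespace UnitaryGroup

open Literature.AlgebraicGeometry.ShimuraVarieties (hermForm)

variable (L : Type) [Field L] [NumberField L] [IsCMField L] (N : ℕ) (H : Matrix (Fin N) (Fin N) L)

/-- **Gelfand–Graev–Piatetski-Shapiro for an anisotropic unitary group.** For `H` anisotropic and any
automorphic measure `μ` on `U(H)(𝔸_{L⁺}) ⧸ U(H)(L⁺)`, the regular representation of `U(H)(𝔸_{L⁺})` on
`L²(μ)` is discretely decomposable (the quotient is compact, `compactSpace_cmDatum_automorphicQuotient`;
apply `AdelicGroupData.isDiscretelyDecomposable_rightRegular_of_locallyCompactSpace`).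
[cite: DeitmarEchterhoff2014, Thm. 9.2.2] [cite: GelfandGraevPiatetskiShapiro1969, Ch. 1 §2] -/
theorem isDiscretelyDecomposable_rightRegular_cmDatum
    (hanis : ∀ x : Fin N → L, hermForm (cmConjRingHom L) H x x = 0 → x = 0)
    (μ : Measure (cmDatum L N H).automorphicQuotient) [(cmDatum L N H).IsAutomorphicMeasure μ] :
    ((cmDatum L N H).rightRegular μ).IsDiscretelyDecomposable := by
  haveI := compactSpace_cmDatum_automorphicQuotient L N H hanis
  exact (cmDatum L N H).isDiscretelyDecomposable_rightRegular_of_locallyCompactSpace μ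

/-- Equivalently `L²_disc = L²` for the unitary datum, `H` anisotropic.
[cite: DeitmarEchterhoff2014, Thm. 9.2.2] -/
theorem discreteSpectrum_cmDatum_eq_top
    (hanis : ∀ x : Fin N → L, hermForm (cmConjRingHom L) H x x = 0 → x = 0)
    (μ : Measure (cmDatum L N H).automorphicQuotient) [(cmDatum L N H).IsAutomorphicMeasure μ] :
    (cmDatum L N H).discreteSpectrum μ = ⊤ := by
  haveI := compactSpace_cmDatum_automorphicQuotient L N H hanis
  exact (cmDatum L N H).discreteSpectrum_eq_top_of_compactSpace μ

/-- The tree's named fact `isDiscretelyDecomposable_rightRegular_of_compactSpace` ("compact quotient ⇒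
`L² = L²_disc`") HOLDS for the unitary datum `cmDatum L N H` (every `H`, every automorphic `μ`):
`U(H)(𝔸_{L⁺})` is locally compact and second countable. [cite: DeitmarEchterhoff2014, Thm. 9.2.2] -/
theorem isDiscretelyDecomposable_rightRegular_of_compactSpace_cmDatum
    (μ : Measure (cmDatum L N H).automorphicQuotient) [(cmDatum L N H).IsAutomorphicMeasure μ] :
    (cmDatum L N H).isDiscretelyDecomposable_rightRegular_of_compactSpace μ :=
  (cmDatum L N H).isDiscretelyDecomposable_rightRegular_of_compactSpace_of_locallyCompact μ

/-- **Packaged form.** For an anisotropic hermitian `H` over a CM field there is an automorphic measure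
`μ` on `U(H)(𝔸_{L⁺}) ⧸ U(H)(L⁺)` (`exists_isAutomorphicMeasure_cmDatum`) and the regular representation
on `L²(μ)` decomposes discretely. [cite: DeitmarEchterhoff2014, Thm. 9.2.2] [cite: Borel1963, §5] -/
theorem exists_isAutomorphicMeasure_isDiscretelyDecomposable_cmDatum
    (hanis : ∀ x : Fin N → L, hermForm (cmConjRingHom L) H x x = 0 → x = 0) :
    ∃ (μ : Measure (cmDatum L N H).automorphicQuotient) (_ : (cmDatum L N H).IsAutomorphicMeasure μ),
      ((cmDatum L N H).rightRegular μ).IsDiscretelyDecomposable := by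
  obtain ⟨μ, hμ⟩ := exists_isAutomorphicMeasure_cmDatum L N H hanis
  exact ⟨μ, hμ, isDiscretelyDecomposable_rightRegular_cmDatum L N H hanis μ⟩

/-- Packaged form for `H` positive definite at one complex embedding (then anisotropic,
`anisotropic_of_posDef_map`). [cite: DeitmarEchterhoff2014, Thm. 9.2.2] -/
theorem exists_isAutomorphicMeasure_isDiscretelyDecomposable_cmDatum_of_posDef (τ : L →+* ℂ)
    (hτ : (H.map τ).PosDef) :
    ∃ (μ : Measure (cmDatum L N H).automorphicQuotient) (_ : (cmDatum L N H).IsAutomorphicMeasure μ),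
      ((cmDatum L N H).rightRegular μ).IsDiscretelyDecomposable :=
  exists_isAutomorphicMeasure_isDiscretelyDecomposable_cmDatum L N H (anisotropic_of_posDef_map L H τ hτ)

/-- Discrete decomposability for the tree's generic unitary datum
`UnitaryGroup.adelicGroupData L⁺ L c N H` (definitionally `cmDatum L N H`), `H` anisotropic, `μ`
automorphic. [cite: DeitmarEchterhoff2014, Thm. 9.2.2] -/
theorem isDiscretelyDecomposable_rightRegular_adelicGroupData
    (hanis : ∀ x : Fin N → L, hermForm (cmConjRingHom L) H x x = 0 → x = 0)
    (μ : Measure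
      (adelicGroupData ↥(maximalRealSubfield L) L (IsCMField.complexConj L) N H).automorphicQuotient)
    [(adelicGroupData ↥(maximalRealSubfield L) L (IsCMField.complexConj L) N H).IsAutomorphicMeasure μ] :
    ((adelicGroupData ↥(maximalRealSubfield L) L (IsCMField.complexConj L) N H).rightRegular μ)
      |>.IsDiscretelyDecomposable := by
  haveI : (cmDatum L N H).IsAutomorphicMeasure μ :=
    ‹(adelicGroupData ↥(maximalRealSubfield L) L (IsCMField.complexConj L) N H).IsAutomorphicMeasure μ›
  exact isDiscretelyDecomposable_rightRegular_cmDatum L N H hanis μ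

/-- Packaged form for the tree's generic unitary datum, `H` anisotropic.
[cite: DeitmarEchterhoff2014, Thm. 9.2.2] [cite: Borel1963, §5] -/
theorem exists_isAutomorphicMeasure_isDiscretelyDecomposable_adelicGroupData
    (hanis : ∀ x : Fin N → L, hermForm (cmConjRingHom L) H x x = 0 → x = 0) :
    ∃ (μ : Measure
        (adelicGroupData ↥(maximalRealSubfield L) L (IsCMField.complexConj L) N H).automorphicQuotient)
      (_ : (adelicGroupData ↥(maximalRealSubfield L) L (IsCMField.complexConj L) N H).IsAutomorphicMeasure μ),
      ((adelicGroupData ↥(maximalRealSubfield L) L (IsCMField.complexConj L) N H).rightRegular μ)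
        |>.IsDiscretelyDecomposable :=
  exists_isAutomorphicMeasure_isDiscretelyDecomposable_cmDatum L N H hanis

end UnitaryGroup

end Literature.NumberTheory.Automorphic

end
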